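import Summits.BirchSwinnertonDyer.BirchSwinnertonDyer.Theorems.BiquadraticEisensteinDescentEisensteinHeartFlatCMInertBadKPrimeDeuringTransport
import Summits.BirchSwinnertonDyer.BirchSwinnertonDyer.Theorems.BiquadraticEisensteinDescentEisensteinHeartFlatCMInertBadKPrimeBranchUnramified
import HarnessLib

set_option linter.dupNamespace false -- `Summit.BirchSwinnertonDyer.BirchSwinnertonDyer.Theorems.…` (summit = sub)
set_option autoImplicit false

/-!
# Crux `EisensteinHeartFlatCMInertBadKPrime` (stmt-BirchSwinnertonDyer-21341), line `hsieh-lambda`, layer 2 (V2):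
# (hψbad) — the branch character ramifies above every bad prime — for ALL thirteen CM `j`

Route `BiquadraticEisensteinDescent` (cell `pub/bsd-wall`, width seat `bsd-wall-cm-bed-w4`). THEOREMS ONLY (no definition, no named
fact, no `sorry`); supports stmt-BirchSwinnertonDyer-21341 as a helper; nothing about the crux's input or any case of BSD is asserted.

`…BranchBadPrimes.not_hasGoodReductionAt_baseChange_cmField` / `not_isUnramifiedAt_compRelNorm_of_bad` (w1) and the frame form
`…BranchUnramified.hψbad_of_frame` are stated for `W.j ∈ maximalCMJInvariants` + `IsCMFieldOfJ K₁ W.j` (they use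
`Deuring_localEulerFactor_ramified` at the primes of `K₁` ramified over `ℚ`). Here the same statements for EVERY CM curve `W/ℚ`
(`W.HasCM`, any of the thirteen `j`) and any quadratic `K₁ ∋ √(cmFieldDiscrOfJ W.j)`: run them on the `ℚ`-isogenous maximal model
`W₁` (`…DeuringTransport.exists_maximal_model`) and transport good reduction of `W ⊗ K₁` / `W₁ ⊗ K₁` at every place
(`…DeuringTransport.hasGoodReductionAt_baseChange_iff_of_isIsogenous`, *AEC* VII.7.2) and badness over `ℚ`
(`IsIsogenous.hasGoodReductionAtPrime_iff`).

References: [SilvermanATAEC1994] Ch. II Thm. 9.2 (b), Ex. 2.31–2.32; [SilvermanAEC2009] Cor. VII.7.2; [Childress2009] Ch. 4 §5 Lemma 5.3 (a).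
-/

noncomputable section

open scoped NumberField IntermediateField
open NumberField IsDedekindDomain IntermediateField WeierstrassCurve
open Literature.NumberTheory.GaloisRepresentations Literature.NumberTheory.EllipticCurves
open Literature.NumberTheory.EllipticCurves.Rank1Residual
open Summit.BirchSwinnertonDyer.BirchSwinnertonDyer.Theorems.BiquadraticEisensteinDescentEisensteinHeartFlatCMInertBadKPrimeDeuringTransport
open Summit.BirchSwinnertonDyer.BirchSwinnertonDyer.Theorems.BiquadraticEisensteinDescentEisensteinHeartFlatCMInertBadKPrimeFrameCMSubfield
open Summit.BirchSwinnertonDyer.BirchSwinnertonDyer.Theorems.BiquadraticEisensteinDescentEisensteinHeartFlatCMInertBadKPrimeBranchUnramified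

namespace Summit.BirchSwinnertonDyer.BirchSwinnertonDyer.Theorems.BiquadraticEisensteinDescentEisensteinHeartFlatCMInertBadKPrimeBranchBadPrimesAllJ

variable {K₁ K L : Type} [Field K₁] [NumberField K₁] [Field K] [NumberField K] [Field L] [NumberField L]

/-- **`E ⊗ K₁` is bad at every prime of the CM field `K₁` above a bad prime `ℓ` of `E/ℚ` — every CM curve** (`W.HasCM`, any order;
`K₁` quadratic with `θ² = cmFieldDiscrOfJ W.j`): w1's `…BranchBadPrimes.not_hasGoodReductionAt_baseChange_cmField` on the maximal model
`W₁ ∼ W`, transported along the isogeny (*AEC* VII.7.2 over `K₁` and over `ℚ`). [cite: SilvermanAEC2009, Cor. VII.7.2]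
[cite: SilvermanATAEC1994, Ch. II Exercises 2.31(a), 2.32(a) (PDF p. 179)] -/
theorem not_hasGoodReductionAt_baseChange_cmField_of_hasCM (W : WeierstrassCurve ℚ) [W.IsElliptic] (hCM : W.HasCM)
    (h2 : Module.finrank ℚ K₁ = 2) (hθ : ∃ θ : K₁, θ ^ 2 = (cmFieldDiscrOfJ W.j : K₁)) {ℓ : ℕ} [Fact ℓ.Prime]
    (hbad : ¬ W.HasGoodReductionAtPrime ℓ) (v : HeightOneSpectrum (𝓞 K₁)) (hv : (ℓ : 𝓞 K₁) ∈ v.asIdeal) :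
    ¬ (W.baseChange K₁).HasGoodReductionAt v := by
  obtain ⟨W₁, hE₁, hmin₁, hiso, hj₁, -, -, hK₁⟩ := exists_maximal_model W hCM h2 hθ
  haveI := hE₁
  rw [hasGoodReductionAt_baseChange_iff_of_isIsogenous hiso v]
  exact BiquadraticEisensteinDescentEisensteinHeartFlatCMInertBadKPrimeBranchBadPrimes.not_hasGoodReductionAt_baseChange_cmField
    W₁ hj₁ K₁ hK₁ (fun h ↦ hbad ((hiso.hasGoodReductionAtPrime_iff ℓ).mpr h)) v hv

/-- **(hψbad) for every CM curve**: `W.HasCM` (any of the thirteen `j`), `K₁` quadratic with `θ² = cmFieldDiscrOfJ W.j`, `L ⊇ K₁`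
Galois, `ψ` a Hecke character of `K₁` with Deuring's clause (iii) FOR `W`, and `L/K₁` unramified above every bad prime of `W` (binder
`hunr`): `ψ ∘ N_{L/K₁}` is ramified at every prime of `L` above every bad prime — the `hψbad` binder of
`…KatzHsiehLValueCM.hLval_of_deuring_of_cmField` / `…DeuringTransport.hLval_of_deuring_of_hasCM`, literally.
[cite: SilvermanATAEC1994, Ch. II Thm. 9.2 (b) (PDF p. 165)] [cite: Childress2009, Ch. 4 §5 Lemma 5.3 (a) (PDF p. 95)] -/
theorem not_isUnramifiedAt_compRelNorm_of_bad_of_hasCM [Algebra K₁ L] [IsGalois K₁ L] (W : WeierstrassCurve ℚ) [W.IsElliptic]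
    (hCM : W.HasCM) (h2 : Module.finrank ℚ K₁ = 2) (hθ : ∃ θ : K₁, θ ^ 2 = (cmFieldDiscrOfJ W.j : K₁))
    {ψ : HeckeCharacter K₁}
    (hψ : ∀ v : HeightOneSpectrum (𝓞 K₁), ψ.IsUnramifiedAt v ↔ (W.baseChange K₁).HasGoodReductionAt v)
    (hunr : ∀ (ℓ : ℕ) [Fact ℓ.Prime], ¬ W.HasGoodReductionAtPrime ℓ →
      ∀ v : HeightOneSpectrum (𝓞 K₁), (ℓ : 𝓞 K₁) ∈ v.asIdeal → Algebra.IsUnramifiedIn (𝓞 L) v.asIdeal) :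
    ∀ (ℓ : ℕ) [Fact ℓ.Prime], ¬ W.HasGoodReductionAtPrime ℓ →
      ∀ w : HeightOneSpectrum (𝓞 L), (ℓ : 𝓞 L) ∈ w.asIdeal → ¬ (ψ.compRelNorm L).IsUnramifiedAt w := by
  intro ℓ _ hbad w hw
  have hv : (ℓ : 𝓞 K₁) ∈ (w.under (𝓞 K₁)).asIdeal :=
    BiquadraticEisensteinDescentEisensteinHeartFlatCMInertBadKPrimeBranchBadPrimes.natCast_mem_under hw
  exact ψ.not_isUnramifiedAt_compRelNorm (hunr ℓ hbad _ hv)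
    (fun h ↦ not_hasGoodReductionAt_baseChange_cmField_of_hasCM W hCM h2 hθ hbad _ hv ((hψ _).mp h)) rfl

/-- **(hψbad) AT THE FRAME `K₁ = ℚ⟮x⟯`, for every CM curve, with no binder beyond Deuring (iii) for `W`**: as w1's
`…BranchUnramified.hψbad_of_frame`, with `W.j ∈ maximalCMJInvariants` replaced by `W.HasCM` and `x² = cmFieldDiscr W.j` by
`x² = cmFieldDiscrOfJ W.j` (the LEAD's frame tie); `hunr` is w1's `hunr_of_frame` (every bad `ℓ ∤ d_K′` — Heegner).
[cite: SilvermanATAEC1994, Ch. II Thm. 9.2 (b) (PDF p. 165)] [cite: Childress2009, Ch. 4 §5 Lemma 5.3 (a) (PDF p. 95)] -/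
theorem hψbad_of_frame_of_hasCM [Algebra K L] (hK : IsImaginaryQuadratic K) (h2 : Module.finrank K L = 2)
    (W : WeierstrassCurve ℚ) [W.IsElliptic] (hCM : W.HasCM) {x : L} (hx : x ^ 2 = (cmFieldDiscrOfJ W.j : L))
    (hxK : x ∉ Set.range (algebraMap K L)) {δ : 𝓞 K} (hδ : δ ^ 2 = (NumberField.discr K : 𝓞 K))
    (hbad : ∀ (ℓ : ℕ) [Fact ℓ.Prime], ¬ W.HasGoodReductionAtPrime ℓ → ¬ (ℓ : ℤ) ∣ NumberField.discr K)
    [IsGalois ℚ⟮x⟯ L] {ψ : HeckeCharacter ℚ⟮x⟯}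
    (hψ : ∀ v : HeightOneSpectrum (𝓞 ℚ⟮x⟯), ψ.IsUnramifiedAt v ↔ (W.baseChange ℚ⟮x⟯).HasGoodReductionAt v) :
    ∀ (ℓ : ℕ) [Fact ℓ.Prime], ¬ W.HasGoodReductionAtPrime ℓ →
      ∀ w : HeightOneSpectrum (𝓞 L), (ℓ : 𝓞 L) ∈ w.asIdeal → ¬ (ψ.compRelNorm L).IsUnramifiedAt w :=
  not_isUnramifiedAt_compRelNorm_of_bad_of_hasCM W hCM (finrank_adjoin_eq_two hx (not_mem_range_rat hxK))
    ⟨AdjoinSimple.gen ℚ x, gen_sq hx⟩ hψ (hunr_of_frame hK h2 hx hxK hδ W hbad)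

/-- **Deuring at the frame for every CM curve**: `hD : Deuring_exists_heckeCharacter_of_maximalCM`, `W.HasCM`, `L ⊇ K′` with
`[L:K′] = 2`, `x ∈ L ∖ K′`, `x² = cmFieldDiscrOfJ W.j`, `τ ∈ Gal(L/K′) ∖ {1}`: a Hecke character `ψ` of `K₁ := ℚ⟮x⟯` with Deuring's
clauses (i)–(v) FOR `W`, for the conjugation `c := (τ|ℚ)|_{ℚ⟮x⟯}` (w1's `restrictNormal_ne_one`), together with the maximal model
`W₁` (for maximal-`j`-only consumers). One call for the `stub_V2` closer. [cite: SilvermanATAEC1994, Ch. II Thm. 9.2 and Thm. 10.5]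
[cite: SilvermanAEC2009, Cor. VII.7.2] -/
theorem exists_deuringCharacter_adjoin [Algebra K L] (hD : Deuring_exists_heckeCharacter_of_maximalCM)
    (h2 : Module.finrank K L = 2) (W : WeierstrassCurve ℚ) [W.IsElliptic] [W.IsGloballyMinimal] (hCM : W.HasCM) {x : L}
    (hx : x ^ 2 = (cmFieldDiscrOfJ W.j : L)) (hxK : x ∉ Set.range (algebraMap K L)) (τ : L ≃ₐ[K] L) (hτ : τ ≠ 1) :
    haveI := isGalois_adjoin hx (not_mem_range_rat hxK)
    ∃ (W₁ : WeierstrassCurve ℚ) (_ : W₁.IsElliptic) (_ : W₁.IsGloballyMinimal),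
      IsIsogenous W W₁ ∧ W₁.j ∈ maximalCMJInvariants ∧ W₁.HasCM ∧ IsCMFieldOfJ ℚ⟮x⟯ W₁.j ∧
      ∃ ψ : HeckeCharacter ℚ⟮x⟯,
        ψ.HasInfinityType (fun _ ↦ 1) (fun _ ↦ 0) ∧
        IsHeckeConjEquivariant ((τ.restrictScalars ℚ).restrictNormal ℚ⟮x⟯) ψ ∧
        (∀ w : HeightOneSpectrum (𝓞 ℚ⟮x⟯), ψ.IsUnramifiedAt w ↔ (W.baseChange ℚ⟮x⟯).HasGoodReductionAt w) ∧
        (∀ w : HeightOneSpectrum (𝓞 ℚ⟮x⟯), ψ.IsUnramifiedAt w ↔ (W₁.baseChange ℚ⟮x⟯).HasGoodReductionAt w) ∧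
        (∀ (p : ℕ) [Fact p.Prime], W.HasGoodReductionAtPrime p →
          ∀ w : HeightOneSpectrum (𝓞 ℚ⟮x⟯), (p : 𝓞 ℚ⟮x⟯) ∈ w.asIdeal →
            ψ.IsUnramifiedAt w ∧
            ((τ.restrictScalars ℚ).restrictNormal ℚ⟮x⟯ • w ≠ w →
              ψ.valueAtUniformizer w + ψ.valueAtUniformizer ((τ.restrictScalars ℚ).restrictNormal ℚ⟮x⟯ • w) =
                (W.frobeniusTrace p : ℂ) ∧
              ψ.valueAtUniformizer w * ψ.valueAtUniformizer ((τ.restrictScalars ℚ).restrictNormal ℚ⟮x⟯ • w) = (p : ℂ)) ∧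
            ((τ.restrictScalars ℚ).restrictNormal ℚ⟮x⟯ • w = w →
              W.frobeniusTrace p = 0 ∧ ψ.valueAtUniformizer w = -(p : ℂ))) ∧
        (∀ s : ℂ, 3 / 2 < s.re → heckeLFunction ψ s = W.LSeries s) := by
  haveI := isGalois_adjoin hx (not_mem_range_rat hxK)
  exact exists_deuringCharacter_of_hasCM hD W hCM (finrank_adjoin_eq_two hx (not_mem_range_rat hxK))
    ⟨AdjoinSimple.gen ℚ x, gen_sq hx⟩ _ (restrictNormal_ne_one h2 hx hxK τ hτ)

end Summit.BirchSwinnertonDyer.BirchSwinnertonDyer.Theorems.BiquadraticEisensteinDescentEisensteinHeartFlatCMInertBadKPrimeBranchBadPrimesAllJ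

end
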